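/-
Copyright (c) 2026 the pub-hodgecm-mathlib formalisation cell (harness21).  Prover seat hodgecm-mathlib-R90-C133-p02 (g2), Track B ∕ R90-TF, h413 = `stmt-HodgeConjecture-24833`,
R90-TF section S8 «ContSpec-n½» (S8 dealer R90-CS-plan (g3) S8-R186 «(α) GENERIC HILBERT»; census `R90/S8/CENSUS-ADM-payer.R90-C133-p02-g2.md` 1918f47b2978fa74 item 2 (α) +
the Schur dichotomy of the (W1′) refinement 2026-09-05T01:3xZ): step (α) of the (ADM) payer road of ★ p863816 `hDISC_of_inv_of_admissible` — GENERIC unitary-representation lemmas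
(any group `K`, any complex Hilbert space `H`): finite `τ`-multiplicity of a closed stable subspace from a generating set whose `τ`-projections span a finite-dimensional space, and
the SCHUR DICHOTOMY for the `τ`-projection of a vector with irreducible finite-dimensional orbit span.
-/
import Literature.NumberTheory.Automorphic.UnitaryIsotypicProjection     -- ★ `Representation.homRangeSum`, `ContRepresentation.subRep ∕ tauPart ∕ tauPart_le ∕ tauPart_le_homRangeSum`, ★ `IsUnitary.starProjection_closure_homRangeSum_mem_tauPart`
import Mathlib.RepresentationTheory.Irreducible                          -- Mathlib `Representation.IsIrreducible.bijective_or_eq_zero ∕ injective_or_eq_zero` (Schur)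
import Mathlib.Topology.Algebra.Module.FiniteDimension                    -- Mathlib `Submodule.closed_of_finiteDimensional`
import Mathlib.RingTheory.SimpleModule.Basic                              -- Mathlib `IsSimpleModule.congr`
import HarnessLib

/-!
# S8 (R)′ road, letter (ADM) step (α) — `R90S8TauPartFiniteOfGeneratorsU3`: FINITE `τ`-MULTIPLICITY OF A CLOSED STABLE SUBSPACE FROM ITS GENERATORS, AND THE SCHUR DICHOTOMY FOR THE
# `τ`-PROJECTION OF A VECTOR WITH IRREDUCIBLE ORBIT SPAN (generic `K`, generic Hilbert space)

Track B ∕ R90-TF, crux h413 = `stmt-HodgeConjecture-24833`, route of record `HCCMUnconditional`; cell `hodgecm-mathlib`, R90-TF section S8 «ContSpec-n½ ∕ ResidualSpectrum», socket (R)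
(B ED. 7 :337) ← ★ `res_midBlock_le_residual_of_letters' (hDISC) …` ← ★ p863816 `hDISC_of_inv_of_admissible (hINV) (hADM)` ← the (ADM) payer road {(α) THIS FILE, (β′) residue graph,
(γ) ★ p863857, (W1′) letter}.  THEOREMS ONLY (no `def`, no `instance`, no `notation`, no named-fact hypothesis, no `sorry`; default heartbeats); lane `--supports stmt-HodgeConjecture-24833
--as helper` (count-neutral).  CLOSES NO SOCKET; letter-free; GENERIC (no `U(2,1)` object occurs): the assembly file instantiates it at `σ := R|_{K_max}` on `L²(U_{L∕L⁺}(3))`,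
`A := resGMidAtom ξ μω ⊥ 1`, `G :=` the (W1′) generators.

THE MATHEMATICS ([WallachRRG1] §1.4.6–1.4.7, §3.3.1; [HarishChandraTAMS1953] Thm. 5; [Dixmier1977] §13.1.2).  `σ : K → B(H)`, `τ` a representation of `K` on `W`, and
`Q_τ` := the orthogonal projection of `H` onto the CLOSURE of the `τ`-part `H(τ) = homRangeSum σ τ` (★ `UnitaryIsotypicProjection`'s projector — no Haar measure, no character).
§1 (no unitarity needed): if a `σ|_K`-stable `A` lies in the closed span of a set `G` and `Q_τ` maps `G` into a finite-dimensional `F`, then the `τ`-part of `σ|_A` is finite-dimensional —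
every `v` in the `τ`-part of `A` (pushed into `H`) lies in `H(τ)`, so `v = Q_τ v ∈ Q_τ (cl span G) ⊆ cl (span (Q_τ G)) ⊆ cl F = F`.  §2 SCHUR: for irreducible `ρ ≄ τ` the `τ`-part of `ρ`
vanishes (a `K`-map `τ → ρ` is bijective or zero, Mathlib `bijective_or_eq_zero`); the range of an injective `K`-map out of an irreducible `ρ` is a stable subspace on which `σ` is
`≃ ρ`, hence irreducible.  §3 (unitary `σ`): THE DICHOTOMY — for `f` in a finite-dimensional stable `N ≤ H` on which `σ` is irreducible, `Q_τ f ∈ N` (★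
`starProjection_closure_homRangeSum_mem_tauPart`: `Q_τ f` lies in the `τ`-part of `N`), and `Q_τ f = 0` unless `τ ≃ σ|_N` (§2).  So a generating set of vectors with irreducible
finite-dimensional orbit spans, all of whose `τ`-equivalent spans lie in ONE finite-dimensional `F`, feeds §1 with that `F` — the shape of the (β′)+(W1′) assembly.
* §1 **`finiteDimensional_homRangeSum_subRep_of_generators`** (`A ≤ cl span G`, `Q_τ '' G ⊆ F` f.d. ⇒ `homRangeSum (σ.subRep A) τ` f.d.).
* §2 `homRangeSum_eq_bot_of_isEmpty_equiv` (Schur), `apply_mem_range_of_mem_range` (ranges of `K`-maps are stable), `nonempty_equiv_subRep_range_of_injective`, `isIrreducible_subRep_range_of_injective`.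
* §3 **`starProjection_closure_homRangeSum_mem_of_mem`**, **`starProjection_closure_homRangeSum_eq_zero_of_isEmpty_equiv`**, and the packaged dichotomy
  **`starProjection_closure_homRangeSum_mem_of_dichotomy`** (`Q_τ f ∈ F` as soon as `N ≤ F` whenever `τ ≃ σ|_N`).
HONEST LABEL: HC_CM is proved only modulo the 7 printed citations (2 remaining named inputs: hLiu418 = `stmt-HodgeConjecture-24832`, h413 = `stmt-HodgeConjecture-24833`) until
rung 0 closes; REL ≠ ★ ≠ BUILT; generic step (α) only — (β′) and the assembly still to file, (INV)∕(W1′) OPEN letters; asserts no named fact and closes no socket; count-neutral.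

## References
* [WallachRRG1] N. R. Wallach, *Real Reductive Groups I* (1988), §1.4.6–1.4.7 (`V(γ)`, Schur), §3.3.1 (admissibility).
* [HarishChandraTAMS1953] Harish-Chandra, *Representations of a semisimple Lie group on a Banach space. I*, Trans. AMS 75 (1953), Thm. 5.
* [Dixmier1977] J. Dixmier, *C\*-algebras* (1977), §13.1.2.
-/

set_option autoImplicit false
set_option linter.dupNamespace false  -- the mandated namespace `…HodgeConjecture.HodgeConjecture.R90.S8` (LEAD #1 L1) repeats the summit's segment

noncomputable section

open ContRepresentation

namespace Summit.HodgeConjecture.HodgeConjecture.R90.S8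

variable {K : Type*} [Group K] {H : Type*} [NormedAddCommGroup H] [InnerProductSpace ℂ H]
  {W : Type*} [AddCommGroup W] [Module ℂ W]

/-! ## §1 Finite `τ`-multiplicity of a closed stable subspace from a generating set -/

section Generators

variable [CompleteSpace H] (σ : ContRepresentation ℂ K H) (τ : Representation ℂ K W)

/-- **FINITE `τ`-MULTIPLICITY FROM GENERATORS**: let `A ≤ H` be `σ`-stable and contained in the closed span of a set `G`, and suppose the orthogonal projection `Q_τ` onto the closure of the
`τ`-part `H(τ) = homRangeSum σ τ` maps every `g ∈ G` into ONE finite-dimensional subspace `F`.  Then the `τ`-part of `σ|_A` is finite-dimensional: for `v` in the `τ`-part of `A` (pushed into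
`H`, ★ `tauPart`), `v ∈ H(τ)` so `Q_τ v = v`, while `v ∈ cl span G` gives `Q_τ v ∈ cl (Q_τ (span G)) ⊆ cl F = F`.  No unitarity is used. [cite: WallachRRG1, §3.3.1] [cite: HarishChandraTAMS1953, Thm. 5] -/
theorem finiteDimensional_homRangeSum_subRep_of_generators
    {A : Submodule ℂ H} (hA : ∀ k, ∀ v ∈ A, σ k v ∈ A) {G : Set H} (hAG : A ≤ (Submodule.span ℂ G).topologicalClosure)
    {F : Submodule ℂ H} [FiniteDimensional ℂ F]
    (hQ : ∀ g ∈ G, (Representation.homRangeSum σ.toRepresentation τ).topologicalClosure.starProjection g ∈ F) :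
    FiniteDimensional ℂ ↥(Representation.homRangeSum (σ.subRep A hA) τ) := by
  have hle : σ.tauPart τ A hA ≤ F := by
    intro v hv
    have hvM : v ∈ (Representation.homRangeSum σ.toRepresentation τ).topologicalClosure :=
      Submodule.le_topologicalClosure _ (tauPart_le_homRangeSum hA hv)
    have hfix : (Representation.homRangeSum σ.toRepresentation τ).topologicalClosure.starProjection v = v :=
      Submodule.starProjection_eq_self_iff.2 hvM
    have hmap : ((Submodule.span ℂ G).topologicalClosure).map
        (((Representation.homRangeSum σ.toRepresentation τ).topologicalClosure.starProjection : H →L[ℂ] H) : H →ₗ[ℂ] H) ≤ F := by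
      refine (Submodule.topologicalClosure_map ((Representation.homRangeSum σ.toRepresentation τ).topologicalClosure.starProjection) _).trans ?_
      rw [← F.closed_of_finiteDimensional.submodule_topologicalClosure_eq]
      exact Submodule.topologicalClosure_mono (Submodule.map_span_le _ _ _ |>.2 hQ)
    rw [← hfix]
    exact hmap ⟨v, hAG (tauPart_le hA hv), rfl⟩
  haveI : FiniteDimensional ℂ ↥((Representation.homRangeSum (σ.subRep A hA) τ).map A.subtype) := Submodule.finiteDimensional_of_le hle
  exact LinearEquiv.finiteDimensional (Submodule.equivMapOfInjective A.subtype A.injective_subtype (Representation.homRangeSum (σ.subRep A hA) τ)).symm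

end Generators

/-! ## §2 Schur: the `τ`-part of an inequivalent irreducible vanishes; ranges of injective `K`-maps out of irreducibles -/

section Schur

variable {V : Type*} [AddCommGroup V] [Module ℂ V] {ρ : Representation ℂ K V} {τ : Representation ℂ K W}

/-- **SCHUR — the `τ`-part of an irreducible `ρ ≄ τ` is zero**: every `K`-map `τ → ρ` between irreducibles is bijective or zero (Mathlib `bijective_or_eq_zero`); a bijective one is an
equivalence. [cite: WallachRRG1, §1.4.6] -/
theorem homRangeSum_eq_bot_of_isEmpty_equiv (hρ : ρ.IsIrreducible) (hτ : τ.IsIrreducible) (h : IsEmpty (τ.Equiv ρ)) :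
    Representation.homRangeSum ρ τ = ⊥ := by
  haveI := hρ
  haveI := hτ
  refine (Submodule.eq_bot_iff _).2 fun v hv => ?_
  induction hv using Submodule.iSup_induction' with
  | mem T v hv =>
    obtain ⟨w, rfl⟩ := hv
    rcases Representation.IsIrreducible.bijective_or_eq_zero T with hb | h0
    · exact (h.false (Representation.Equiv.mk (LinearEquiv.ofBijective T.toLinearMap hb) fun g => LinearMap.ext fun x => by
        simp only [LinearMap.coe_comp, Function.comp_apply, LinearEquiv.coe_coe, LinearEquiv.ofBijective_apply, Representation.IntertwiningMap.toLinearMap_apply]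
        exact Representation.IntertwiningMap.isIntertwining _ _ T g x)).elim
    · rw [Representation.IntertwiningMap.toLinearMap_apply, h0, Representation.IntertwiningMap.coe_zero, Pi.zero_apply]
  | zero => rfl
  | add v v' _ _ hv hv' => rw [hv, hv', add_zero]

variable (σ : ContRepresentation ℂ K H)

/-- The range of a `K`-map `ρ → σ` is `σ`-stable. [folklore] -/
theorem apply_mem_range_of_mem_range (T : ρ.IntertwiningMap σ.toRepresentation) (k : K) {v : H} (hv : v ∈ LinearMap.range T.toLinearMap) :
    σ k v ∈ LinearMap.range T.toLinearMap := by
  obtain ⟨x, rfl⟩ := hv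
  exact ⟨ρ k x, (Representation.IntertwiningMap.isIntertwining _ _ T k x).trans rfl⟩

/-- **An injective `K`-map `T : ρ → σ` is an equivalence onto its range** (Mathlib `LinearEquiv.ofInjective`; stated as `Nonempty` — theorems only). [cite: WallachRRG1, §1.4.6] -/
theorem nonempty_equiv_subRep_range_of_injective (T : ρ.IntertwiningMap σ.toRepresentation) (hT : Function.Injective T) :
    Nonempty (ρ.Equiv (σ.subRep (LinearMap.range T.toLinearMap) (apply_mem_range_of_mem_range σ T))) :=
  ⟨Representation.Equiv.mk (LinearEquiv.ofInjective T.toLinearMap hT) fun g => LinearMap.ext fun x => Subtype.ext (by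
    simp only [LinearMap.coe_comp, Function.comp_apply, LinearEquiv.coe_coe, LinearEquiv.ofInjective_apply, coe_subRep_apply, Representation.IntertwiningMap.toLinearMap_apply]
    exact Representation.IntertwiningMap.isIntertwining _ _ T g x)⟩

/-- **The range of an injective `K`-map out of an irreducible `ρ` carries an irreducible `σ|_{range T}`** (irreducibility along the equivalence of the previous theorem: Mathlib
`IsIrreducible = IsSimpleModule ℂ[K] (asModule ·)` transported by `IsSimpleModule.congr`). [cite: WallachRRG1, §1.4.6] -/
theorem isIrreducible_subRep_range_of_injective (hρ : ρ.IsIrreducible) (T : ρ.IntertwiningMap σ.toRepresentation) (hT : Function.Injective T) :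
    (σ.subRep (LinearMap.range T.toLinearMap) (apply_mem_range_of_mem_range σ T)).IsIrreducible := by
  obtain ⟨e⟩ := nonempty_equiv_subRep_range_of_injective σ T hT
  rw [Representation.irreducible_iff_isSimpleModule_asModule] at hρ ⊢
  have hf : Function.Bijective (Representation.IntertwiningMap.equivLinearMapAsModule _ _ e.toIntertwiningMap) := e.toLinearEquiv.bijective
  exact IsSimpleModule.congr (LinearEquiv.ofBijective _ hf).symm

end Schur

/-! ## §3 Unitary `σ`: the Schur dichotomy for the `τ`-projection of a vector with irreducible finite-dimensional orbit span -/

section Dichotomy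

variable [CompleteSpace H] (σ : ContRepresentation ℂ K H) (τ : Representation ℂ K W)

/-- **`Q_τ f ∈ N` for `f` in a finite-dimensional stable `N`** (unitary `σ`): the orthogonal projection onto the closure of the `τ`-part of `H` maps `N` into the `τ`-part of `N`, in particular
into `N` (★ `IsUnitary.starProjection_closure_homRangeSum_mem_tauPart` + ★ `tauPart_le`). [cite: HarishChandraTAMS1953, Thm. 5] [cite: WallachRRG1, §1.4.7] -/
theorem starProjection_closure_homRangeSum_mem_of_mem (hσ : σ.IsUnitary) {N : Submodule ℂ H} [FiniteDimensional ℂ N] (hN : ∀ k, ∀ v ∈ N, σ k v ∈ N)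
    {f : H} (hf : f ∈ N) :
    (Representation.homRangeSum σ.toRepresentation τ).topologicalClosure.starProjection f ∈ N :=
  tauPart_le hN (hσ.starProjection_closure_homRangeSum_mem_tauPart (τ := τ) hN hf)

/-- **`Q_τ f = 0` when `σ|_N` is irreducible and `≄ τ`** (unitary `σ`, `τ` irreducible, `f ∈ N` finite-dimensional stable): `Q_τ f` lies in the `τ`-part of `N` (★), which is the image of
`homRangeSum (σ|_N) τ = ⊥` (§2 Schur). [cite: WallachRRG1, §1.4.6–1.4.7] -/
theorem starProjection_closure_homRangeSum_eq_zero_of_isEmpty_equiv (hσ : σ.IsUnitary) {N : Submodule ℂ H} [FiniteDimensional ℂ N] (hN : ∀ k, ∀ v ∈ N, σ k v ∈ N)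
    (hirr : (σ.subRep N hN).IsIrreducible) (hτ : τ.IsIrreducible) (he : IsEmpty (τ.Equiv (σ.subRep N hN))) {f : H} (hf : f ∈ N) :
    (Representation.homRangeSum σ.toRepresentation τ).topologicalClosure.starProjection f = 0 := by
  have h := hσ.starProjection_closure_homRangeSum_mem_tauPart (τ := τ) hN hf
  have h0 : σ.tauPart τ N hN = ⊥ := by
    unfold ContRepresentation.tauPart
    rw [homRangeSum_eq_bot_of_isEmpty_equiv hirr hτ he, Submodule.map_bot]
  rw [h0, Submodule.mem_bot] at h
  exact h

/-- **THE DICHOTOMY, PACKAGED FOR §1**: unitary `σ`, irreducible `τ`, `f` in a finite-dimensional stable `N` with `σ|_N` irreducible, and a subspace `F` containing `N` whenever `τ ≃ σ|_N`;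
then `Q_τ f ∈ F` (it is `0 ∈ F` if `τ ≄ σ|_N`, and lies in `N ≤ F` otherwise).  With `G` a set of such `f` and ONE finite-dimensional `F`, §1 applies. [cite: WallachRRG1, §1.4.6–1.4.7, §3.3.1] -/
theorem starProjection_closure_homRangeSum_mem_of_dichotomy (hσ : σ.IsUnitary) {N : Submodule ℂ H} [FiniteDimensional ℂ N] (hN : ∀ k, ∀ v ∈ N, σ k v ∈ N)
    (hirr : (σ.subRep N hN).IsIrreducible) (hτ : τ.IsIrreducible) {F : Submodule ℂ H} (hF : Nonempty (τ.Equiv (σ.subRep N hN)) → N ≤ F) {f : H} (hf : f ∈ N) :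
    (Representation.homRangeSum σ.toRepresentation τ).topologicalClosure.starProjection f ∈ F := by
  by_cases he : Nonempty (τ.Equiv (σ.subRep N hN))
  · exact hF he (starProjection_closure_homRangeSum_mem_of_mem σ τ hσ hN hf)
  · rw [starProjection_closure_homRangeSum_eq_zero_of_isEmpty_equiv σ τ hσ hN hirr hτ (not_nonempty_iff.1 he) hf]
    exact F.zero_mem

end Dichotomy

end Summit.HodgeConjecture.HodgeConjecture.R90.S8

end
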